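import Summits.MatrixMultiplication.MatrixMultiplication.Theses.LevelGradedCohnUmans
import Literature.RepresentationTheory.FiniteGroups.IrreducibleCharacters

/-!
# Negative lemmas for the crux `LieRankDesigns` (stmt-MatrixMultiplication-7614), part A: basics

Refuter-side (cdisprove) load-bearing analysis of `LevelGradedCohnUmans.LieRankDesigns`; no theorem
here asserts a Theses statement positively.  Contents:

* vocabulary `fourierFn`, `RankSupp`, `RankSep`, `levelSet`, `budget`, `volume` with
  `lieRankDesigns_iff : LieRankDesigns ↔ …` by `Iff.rfl` (so the lemmas are about the crux as filed);
* `one_le_budget`, `two_le_volume`: the graded budget is `≥ 1` (trivial character = rank-`0` mode),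
  hence witnesses have volume `≥ 2`;
* `not_lieRankDesigns_levelZero`: the slice `k = 0` of the crux is FALSE for every `ε > 0`;
* `not_lieRankDesigns_rankZeroMatrices`: the slice `m = 0` is FALSE;
* `budget_levelZero` (`= 1`) and `lieRankDesigns_le_variant`: the `≤`-weakening is trivially TRUE —
  the strict `<` is load-bearing and tight at the singleton design.

Parts B (walls, pigeonhole) and C (TPP, abelian slice `m = 1`) import this file.
-/

noncomputable section

open scoped BigOperators
open Literature.RepresentationTheory.FiniteGroups

namespace Summit.MatrixMultiplication.MatrixMultiplication.Theorems.LieRankDesigns.Negative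

open Summit.MatrixMultiplication.MatrixMultiplication.Theses.LevelGradedCohnUmans

/-! ## Vocabulary (definitionally equal to the inlined clauses of the crux) -/

/-- `GL_m(𝔽_p)` as in the crux. -/
abbrev GLm (p m : ℕ) : Type := Matrix.GeneralLinearGroup (Fin m) (ZMod p)

/-- `M_m(𝔽_p)`, the Fourier side. -/
abbrev Mat (p m : ℕ) : Type := Matrix (Fin m) (Fin m) (ZMod p)

variable {p m : ℕ}

/-- The Fourier function `g ↦ Σ_M c_M ψ(tr(M g))` with coefficient table `c` (`ψ = ZMod.stdAddChar`). -/
def fourierFn [Fact p.Prime] (c : Mat p m → ℂ) (g : GLm p m) : ℂ :=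
  ∑ M : Mat p m, c M * ZMod.stdAddChar (Matrix.trace (M * (g : Mat p m)))

/-- "Fourier rank ≤ k": the coefficient table vanishes on matrices of rank `> k`. -/
def RankSupp [Fact p.Prime] (k : ℕ) (c : Mat p m → ℂ) : Prop :=
  ∀ M : Mat p m, k < M.rank → c M = 0

/-- `F_k`-separation of the triple `(X, Y, Z)`, literally the first clause of the crux. -/
def RankSep [Fact p.Prime] (k : ℕ) (X Y Z : Finset (GLm p m)) : Prop :=
  ∀ x₀ ∈ X, ∀ z₀ ∈ Z, ∃ c : Mat p m → ℂ, RankSupp k c ∧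
    ∀ x ∈ X, ∀ y ∈ Y, ∀ y' ∈ Y, ∀ z ∈ Z,
      fourierFn c (x⁻¹ * y * y'⁻¹ * z) = if x = x₀ ∧ y = y' ∧ z = z₀ then 1 else 0

/-- The level-`k` test space `F_k` restricted to `GL_m(𝔽_p)` (as a set of functions). -/
def levelSet (p m : ℕ) [Fact p.Prime] (k : ℕ) : Set (GLm p m → ℂ) :=
  {f | ∃ c : Mat p m → ℂ, RankSupp k c ∧ ∀ g : GLm p m, f g = fourierFn c g}

/-- The graded budget `Σ_{χ ∈ Irr(GL_m(𝔽_p)) ∩ F_k} χ(1)^s`. -/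
def budget (p m : ℕ) [Fact p.Prime] (k : ℕ) (s : ℝ) : ℝ :=
  ∑ᶠ χ ∈ irrChars (GLm p m) ∩ levelSet p m k, (χ 1).re ^ s

/-- The volume `|X||Y||Z|` as a real number (cast of the natural number, as in the crux). -/
def volume (X Y Z : Finset (GLm p m)) : ℝ := ((X.card * Y.card * Z.card : ℕ) : ℝ)

/-- The crux, restated in this vocabulary — by `Iff.rfl`, so nothing below drifts from the
statement as filed. -/
theorem lieRankDesigns_iff :
    LieRankDesigns ↔ ∀ ε : ℝ, 0 < ε → ∃ (p : ℕ) (_ : Fact p.Prime) (m k : ℕ)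
      (X Y Z : Finset (GLm p m)), RankSep k X Y Z ∧ budget p m k (2 + ε) < volume X Y Z ^ ((2 + ε) / 3) :=
  Iff.rfl

/-! ## The budget is never below 1 (trivial character); hence witnesses have volume ≥ 2 -/

section Budget

variable [Fact p.Prime]

/-- The coefficient table of the constant function `1`: `δ_{M = 0}`. -/
def constCoeff (p m : ℕ) : Mat p m → ℂ := fun M => if M = 0 then 1 else 0

/-- The constant table is supported in rank `0 ≤ k`. [folklore] -/
theorem rankSupp_constCoeff (k : ℕ) : RankSupp (p := p) (m := m) k (constCoeff p m) := by
  intro M hM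
  unfold constCoeff
  split_ifs with h
  · subst h; simp at hM
  · rfl

/-- The Fourier function of the constant table is `1`. [folklore] -/
theorem fourierFn_constCoeff (g : GLm p m) : fourierFn (constCoeff p m) g = 1 := by
  unfold fourierFn constCoeff
  simp [Finset.sum_ite_eq']

/-- The trivial character of any group is the constant function `1`. -/
theorem character_trivial_apply {G : Type} [Group G] (g : G) :
    (Representation.trivial ℂ G ℂ).character g = 1 := by
  simp [Representation.character, Representation.trivial]

/-- The trivial character lies in every level `F_k` (it is the rank-`0` Fourier mode `M = 0`). -/
theorem trivial_mem_levelSet (k : ℕ) :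
    (Representation.trivial ℂ (GLm p m) ℂ).character ∈ irrChars (GLm p m) ∩ levelSet p m k :=
  ⟨character_trivial_mem_irrChars,
    ⟨constCoeff p m, rankSupp_constCoeff k, fun g => by
      rw [character_trivial_apply, fourierFn_constCoeff]⟩⟩

/-- Every irreducible character has `χ(1) = d ∈ ℕ`, so `(χ 1).re ≥ 0`. -/
theorem re_apply_one_nonneg {G : Type} [Group G] {χ : G → ℂ} (h : χ ∈ irrChars G) :
    0 ≤ (χ 1).re := by
  obtain ⟨d, -, hd⟩ := IsIrrChar.exists_apply_one h
  rw [hd]; simp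

/-- **The graded budget is at least `1`** for every level `k` and every real exponent `s`:
the trivial character contributes `1^s = 1` and all other terms are `≥ 0` (the family of
irreducible characters is finite, `irrChars_finite_holds`, so the `finsum` is a genuine sum). -/
theorem one_le_budget (k : ℕ) (s : ℝ) : 1 ≤ budget p m k s := by
  classical
  unfold budget
  rw [finsum_mem_def]
  set S := irrChars (GLm p m) ∩ levelSet p m k with hS
  have hfin : (Function.support (S.indicator fun χ => (χ 1).re ^ s)).Finite :=
    ((irrChars_finite_holds (GLm p m)).subset Set.inter_subset_left).subset
      Set.support_indicator_subset
  have hnn : ∀ χ, 0 ≤ S.indicator (fun χ => (χ 1).re ^ s) χ := by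
    intro χ
    by_cases hχ : χ ∈ S
    · rw [Set.indicator_of_mem hχ]
      exact Real.rpow_nonneg (re_apply_one_nonneg hχ.1) s
    · rw [Set.indicator_of_notMem hχ]
  have h1 := single_le_finsum (Representation.trivial ℂ (GLm p m) ℂ).character hfin hnn
  rw [Set.indicator_of_mem (trivial_mem_levelSet k), character_trivial_apply] at h1
  simpa using h1

/-- **Witnesses have volume at least `2`**: with `|X||Y||Z| ∈ {0, 1}` the right-hand side of the
crux is `0` or `1`, never above the budget (`≥ 1`).  So the empty and the singleton designs are
excluded by the strict inequality. -/
theorem two_le_volume {k : ℕ} {ε : ℝ} (hε : 0 < ε) {X Y Z : Finset (GLm p m)}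
    (h : budget p m k (2 + ε) < volume X Y Z ^ ((2 + ε) / 3)) :
    2 ≤ X.card * Y.card * Z.card := by
  by_contra hlt
  push Not at hlt
  have h1 := one_le_budget (p := p) (m := m) k (2 + ε)
  unfold volume at h
  interval_cases hV : X.card * Y.card * Z.card
  · rw [Nat.cast_zero, Real.zero_rpow (by positivity)] at h
    linarith
  · rw [Nat.cast_one, Real.one_rpow] at h
    linarith

end Budget

/-! ## Level `k = 0` is dead (constants separate nothing) -/

section LevelZero

variable [Fact p.Prime]

/-- A nonzero matrix over a field has positive rank. -/
theorem rank_pos_of_ne_zero {M : Mat p m} (hM : M ≠ 0) : 0 < M.rank := by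
  rw [Nat.pos_iff_ne_zero]
  intro h0
  apply hM
  have hbot : LinearMap.range M.mulVecLin = ⊥ := Submodule.finrank_eq_zero.mp h0
  ext i j
  have := LinearMap.range_eq_bot.mp hbot
  have hv : M.mulVecLin (Pi.single j 1) = 0 := by rw [this]; rfl
  rw [Matrix.mulVecLin_apply, Matrix.mulVec_single_one] at hv
  exact congrFun hv i

/-- At level `0` every test function is constant (`= c 0`). -/
theorem fourierFn_const_of_rankSupp_zero {c : Mat p m → ℂ} (hc : RankSupp 0 c) (g : GLm p m) :
    fourierFn c g = c 0 := by
  classical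
  unfold fourierFn
  rw [Finset.sum_eq_single (0 : Mat p m)]
  · simp
  · intro M _ hM
    rw [hc M (rank_pos_of_ne_zero hM), zero_mul]
  · intro h; exact absurd (Finset.mem_univ _) h

/-- **Level `0` separates only the trivial design**: if `(X, Y, Z)` is `F_0`-separated then
`|X||Y||Z| ≤ 1`. -/
theorem volume_le_one_of_rankSep_zero {X Y Z : Finset (GLm p m)} (h : RankSep 0 X Y Z) :
    X.card * Y.card * Z.card ≤ 1 := by
  classical
  by_contra hV
  push Not at hV
  -- all three sets are nonempty
  have hX : X.Nonempty := Finset.card_pos.mp (Nat.pos_of_ne_zero fun h0 => by simp [h0] at hV)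
  have hY : Y.Nonempty := Finset.card_pos.mp (Nat.pos_of_ne_zero fun h0 => by simp [h0] at hV)
  have hZ : Z.Nonempty := Finset.card_pos.mp (Nat.pos_of_ne_zero fun h0 => by simp [h0] at hV)
  obtain ⟨x₀, hx₀⟩ := hX
  obtain ⟨y₀, hy₀⟩ := hY
  obtain ⟨z₀, hz₀⟩ := hZ
  obtain ⟨c, hc, hsep⟩ := h x₀ hx₀ z₀ hz₀
  have hconst := fourierFn_const_of_rankSupp_zero hc
  have htarget := hsep x₀ hx₀ y₀ hy₀ y₀ hy₀ z₀ hz₀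
  rw [hconst, if_pos ⟨rfl, rfl, rfl⟩] at htarget
  -- one of the three sets has two elements
  have hbig : 1 < X.card ∨ 1 < Y.card ∨ 1 < Z.card := by
    by_contra hh
    push Not at hh
    obtain ⟨h1, h2, h3⟩ := hh
    have : X.card * Y.card * Z.card ≤ 1 * 1 * 1 := by gcongr
    omega
  rcases hbig with h1 | h1 | h1
  · obtain ⟨x₁, hx₁, hne⟩ := Finset.exists_mem_ne h1 x₀
    have := hsep x₁ hx₁ y₀ hy₀ y₀ hy₀ z₀ hz₀
    rw [hconst, if_neg (fun hh => hne hh.1), htarget] at this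
    exact one_ne_zero this
  · obtain ⟨y₁, hy₁, hne⟩ := Finset.exists_mem_ne h1 y₀
    have := hsep x₀ hx₀ y₁ hy₁ y₀ hy₀ z₀ hz₀
    rw [hconst, if_neg (fun hh => hne hh.2.1), htarget] at this
    exact one_ne_zero this
  · obtain ⟨z₁, hz₁, hne⟩ := Finset.exists_mem_ne h1 z₀
    have := hsep x₀ hx₀ y₀ hy₀ y₀ hy₀ z₁ hz₁
    rw [hconst, if_neg (fun hh => hne hh.2.2), htarget] at this
    exact one_ne_zero this

/-- No level-`0` design beats any exponent `2 + ε`, `ε > 0`. -/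
theorem not_design_levelZero {ε : ℝ} (hε : 0 < ε) {X Y Z : Finset (GLm p m)}
    (h : RankSep 0 X Y Z) : ¬ budget p m 0 (2 + ε) < volume X Y Z ^ ((2 + ε) / 3) := fun hlt =>
  absurd (volume_le_one_of_rankSep_zero h) (by have := two_le_volume hε hlt; omega)

end LevelZero

/-- **STRENGTHENING REFUTED (level `0`).**  The slice `k = 0` of `LieRankDesigns` is false: for
no `ε > 0` is there a level-`0` design (any prime, any `m`). Any proof of the crux must use
Fourier modes of positive rank. -/
theorem not_lieRankDesigns_levelZero :
    ¬ (∀ ε : ℝ, 0 < ε → ∃ (p : ℕ) (_ : Fact p.Prime) (m : ℕ) (X Y Z : Finset (GLm p m)),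
        RankSep 0 X Y Z ∧ budget p m 0 (2 + ε) < volume X Y Z ^ ((2 + ε) / 3)) := by
  intro h
  obtain ⟨p, hp, m, X, Y, Z, hsep, hlt⟩ := h 1 one_pos
  exact not_design_levelZero one_pos hsep hlt

/-! ## `m = 0` is dead (the trivial group) -/

section RankZeroMatrices

/-- `GL_0` is the trivial group. [folklore] -/
instance : Subsingleton (GLm p 0) := by
  unfold GLm
  infer_instance

/-- In `GL_0` every finite set has at most one element, so the volume is `≤ 1`. -/
theorem volume_le_one_of_m_zero (X Y Z : Finset (GLm p 0)) : X.card * Y.card * Z.card ≤ 1 := by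
  have hX : X.card ≤ 1 := Finset.card_le_one.mpr fun a _ b _ => Subsingleton.elim a b
  have hY : Y.card ≤ 1 := Finset.card_le_one.mpr fun a _ b _ => Subsingleton.elim a b
  have hZ : Z.card ≤ 1 := Finset.card_le_one.mpr fun a _ b _ => Subsingleton.elim a b
  calc X.card * Y.card * Z.card ≤ 1 * 1 * 1 := by gcongr
    _ = 1 := rfl

end RankZeroMatrices

/-- **STRENGTHENING REFUTED (`m = 0`).**  The slice `m = 0` (`GL_0(𝔽_p)` is the trivial group) of
`LieRankDesigns` is false for every `ε > 0`. -/
theorem not_lieRankDesigns_rankZeroMatrices :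
    ¬ (∀ ε : ℝ, 0 < ε → ∃ (p : ℕ) (_ : Fact p.Prime) (k : ℕ) (X Y Z : Finset (GLm p 0)),
        RankSep k X Y Z ∧ budget p 0 k (2 + ε) < volume X Y Z ^ ((2 + ε) / 3)) := by
  intro h
  obtain ⟨p, hp, k, X, Y, Z, -, hlt⟩ := h 1 one_pos
  have := two_le_volume one_pos hlt
  have := volume_le_one_of_m_zero X Y Z
  omega


/-! ## TIGHTNESS: at level `0` the budget is exactly `1`, and the `≤`-variant of the crux is trivially true -/

section Tightness

variable [Fact p.Prime]

/-- A constant irreducible character is the trivial character (`⟨χ, χ⟩ = 1` forces the constant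
to be `±1`, and `χ(1) = dim ≥ 0`). -/
theorem eq_trivial_of_const {G : Type} [Group G] [Fintype G] {χ : G → ℂ} (hχ : χ ∈ irrChars G)
    {K : ℂ} (hK : ∀ g, χ g = K) : χ = (Representation.trivial ℂ G ℂ).character := by
  classical
  have h1 : classInner χ χ = 1 := by rw [IsIrrChar.classInner_eq hχ hχ, if_pos rfl]
  rw [classInner_apply] at h1
  simp_rw [hK] at h1
  rw [Finset.sum_const, Finset.card_univ, nsmul_eq_mul, ← mul_assoc, inv_mul_cancel₀
    (Nat.cast_ne_zero.mpr Fintype.card_ne_zero), one_mul] at h1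
  obtain ⟨d, -, hd⟩ := IsIrrChar.exists_apply_one hχ
  have hKd : K = d := (hK 1).symm.trans hd
  rw [hKd] at h1
  have hd1 : d = 1 := by
    have : (d : ℂ) * d = (d * d : ℕ) := by push_cast; ring
    rw [this, show (1 : ℂ) = ((1 : ℕ) : ℂ) from Nat.cast_one.symm] at h1
    have h2 : d * d = 1 := Nat.cast_injective h1
    exact Nat.eq_one_of_mul_eq_one_left h2
  funext g
  rw [hK, character_trivial_apply, hKd, hd1, Nat.cast_one]

/-- **At level `0` the graded budget is exactly `1`** (only the trivial character is constant). -/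
theorem budget_levelZero (s : ℝ) : budget p m 0 s = 1 := by
  have hset : irrChars (GLm p m) ∩ levelSet p m 0 =
      {(Representation.trivial ℂ (GLm p m) ℂ).character} := by
    ext χ
    constructor
    · rintro ⟨hχ, c, hc, hfc⟩
      exact eq_trivial_of_const hχ (K := c 0) fun g => by
        rw [hfc, fourierFn_const_of_rankSupp_zero hc]
    · rintro rfl
      exact trivial_mem_levelSet 0
  unfold budget
  rw [hset, finsum_mem_singleton, character_trivial_apply]
  simp

/-- The singleton design is `F_0`-separated. -/
theorem rankSep_singleton : RankSep (p := p) (m := m) 0 {1} {1} {1} := by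
  intro x₀ hx₀ z₀ hz₀
  refine ⟨constCoeff p m, rankSupp_constCoeff 0, fun x hx y hy y' hy' z hz => ?_⟩
  rw [Finset.mem_singleton] at hx₀ hz₀ hx hy hy' hz
  subst hx₀ hz₀ hx hy hy' hz
  rw [fourierFn_constCoeff, if_pos ⟨rfl, rfl, rfl⟩]

end Tightness

/-- **WEAKENING IS TRIVIAL (`≤` for `<`).**  With the strict inequality relaxed to `≤`, the crux holds
for every `ε > 0` by the singleton design at level `0` (budget `= 1 = 1^{(2+ε)/3}`): the strictness of
`<` in `LieRankDesigns` is load-bearing, and the crux is TIGHT at the trivial design. -/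
theorem lieRankDesigns_le_variant :
    ∀ ε : ℝ, 0 < ε → ∃ (p : ℕ) (_ : Fact p.Prime) (m k : ℕ) (X Y Z : Finset (GLm p m)),
      RankSep k X Y Z ∧ budget p m k (2 + ε) ≤ volume X Y Z ^ ((2 + ε) / 3) := by
  intro ε _
  refine ⟨2, ⟨Nat.prime_two⟩, 1, 0, {1}, {1}, {1}, rankSep_singleton, ?_⟩
  rw [budget_levelZero]
  simp [volume]


end Summit.MatrixMultiplication.MatrixMultiplication.Theorems.LieRankDesigns.Negative

end
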